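import Literature.Analysis.FunctionSpaces.TorusLinearisedNSForcedEnergy
import Literature.Analysis.FunctionSpaces.TorusClassicalNSDifferenceSmoothing
import HarnessLib

/-!
# The inhomogeneous linearised Navier–Stokes equation on the flat torus, II: the `H¹` balance
# and its flux bound with an `L²` source

Function-space support file (all results proved; no definitions, no named facts), the `H¹` sequel
of `TorusLinearisedNSForcedEnergy` (energy identity and Grönwall for
`∂ₜw + (u·∇)w + (w·∇)u = νΔw − ∇q + g`, `div w = 0`, along a jointly smooth field `u` on
`[a, b] × T^d`; clauses as separate hypotheses, no predicate) and the inhomogeneous twin of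
`FluidPDE/TorusLinearisedNSH1Balance` (`g = 0`):

* `Torus.linearisedNSForced_hasDerivWithinAt_gradNormSq` — the enstrophy identity
  `d/dt ‖∇w‖₂² = −2ν‖Δw‖₂² + 2∫ ⟪(u·∇)w + (w·∇)u, Δw⟫ − 2∫ ⟪g, Δw⟫` within `[a, b]`
  (`‖∇w‖₂² = −∫⟪Δw, w⟫`, `∂ₜ` commutes with `Δ`, Green's second identity, and the pressure term
  `∫⟪∇q, Δw⟫` vanishes because `Δw` is divergence free; incompressibility of `u` is not needed);
* `Torus.linearisedNSForced_gradNormSq_flux_le` — for `ν > 0` and coefficient bounds `‖u‖ ≤ M`,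
  `‖∂ᵢu‖ ≤ Cᵢ` the flux is absorbed keeping HALF the dissipation:
  `V' ≤ −ν‖Δw‖₂² + ν⁻¹(4|d|M² ‖∇w‖₂² + 4(∑ᵢCᵢ)² ∫‖w‖² + 2∫‖g‖²)` (Young and
  `‖(u·∇)w + (w·∇)u‖₂² ≤ 2|d|M²‖∇w‖₂² + 2(∑ᵢCᵢ)²‖w‖₂²`, Temam's (6.17)).

These are the `V`-level estimates of the first variation equation with a right-hand side
(Constantin–Foias 1988, Prop. 13.2 / Ch. 14; Temam 1997, Ch. III §6.1, proof of Lemma 6.1,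
`½ d/dt‖w‖²_V = (w', Aw)`, with `w' + νAw = h`), used for the `H¹` size of linearisation
remainders and of higher variations, whose sources are quadratic in lower-order quantities.

## Mathlib / tree search

Tree (`lean search 'linearisedNSForced'`): part I only; reused:
`Torus.timeDerivWithin_laplacian_comm` (`TorusInverseLaplacianCalculus`),
`Torus.integral_inner_laplacian_comm`, `Torus.integral_inner_gradient_eq_zero_of_isDivFree`,
`Literature.Analysis.FluidPDE.Torus.IsDivFree.laplacian_of_isSmooth`,
`Literature.Analysis.FluidPDE.Torus.integral_inner_laplacian_self_eq_neg_gradNormSq`,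
`Literature.Analysis.FluidPDE.Torus.neg_mul_integral_norm_sq_add_integral_inner_le` (Young),
`Torus.integral_norm_sq_convect_add_convect_le` (`TorusClassicalNSDifferenceBalances`); the pattern
is `Torus.IsClassicalNSSolutionOn.hasDerivWithinAt_gradNormSq_sub`. Mathlib: `norm_sub_le`,
`integral_mono`.

## References

* P. Constantin, C. Foias, *Navier–Stokes Equations*, Univ. Chicago Press 1988, Prop. 13.2 and
  Ch. 14, (14.3)–(14.4), Lemma 14.3. [`ConstantinFoiasNSE1988`]
* R. Temam, *Infinite-Dimensional Dynamical Systems in Mechanics and Physics*, 2nd ed., Springer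
  1997, Ch. III §6.1 (proof of Lemma 6.1) and §6.2 (6.16)–(6.17). [`Temam1997`]
-/

open MeasureTheory Set Filter
open scoped InnerProductSpace ContDiff Topology

noncomputable section

namespace Literature.Analysis.FunctionSpaces

namespace Torus

variable {d : Type*} [Fintype d] [DecidableEq d]

variable {a b ν : ℝ} {u w g : ℝ → UnitAddTorus d → EuclideanSpace ℝ d}
  {q : ℝ → UnitAddTorus d → ℝ}

/-- **Enstrophy identity for the inhomogeneous linearised Navier–Stokes equation.** Let `u` be
jointly smooth on `[a, b] × T^d` (`a < b`), let `(w, q)` be jointly smooth with `div w(t) = 0`, let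
the slices `g(t)` be smooth, and let `∂ₜw + (u·∇)w + (w·∇)u = νΔw − ∇q + g` hold pointwise on
`[a, b] × T^d` (one-sided time derivative within `[a, b]`). Then, within `[a, b]`,
`d/dt ‖∇w‖₂² = −2ν ∫‖Δw‖² + 2∫ ⟪(u·∇)w + (w·∇)u, Δw⟫ − 2∫ ⟪g, Δw⟫`: `‖∇w‖₂² = −∫⟪Δw, w⟫`,
`∂ₜ` commutes with `Δ`, Green's second identity gives `d/dt ∫⟪Δw, w⟫ = 2∫⟪∂ₜw, Δw⟫`, and
`∫⟪∇q, Δw⟫ = 0` because `Δw` is divergence free (Temam 1997, Ch. III §6.1, proof of Lemma 6.1: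
`½ d/dt‖w‖²_V = (w', Aw)` for `w' + νAw = h`). [cite: Temam1997, Ch. III §6.1 Lemma 6.1] -/
theorem linearisedNSForced_hasDerivWithinAt_gradNormSq
    (hu : IsSmoothSpaceTimeOn (Icc a b) u)
    (hw : IsSmoothSpaceTimeOn (Icc a b) w) (hq : IsSmoothSpaceTimeOn (Icc a b) q)
    (hwdiv : ∀ t ∈ Icc a b, IsDivFree (w t)) (hg : ∀ t ∈ Icc a b, IsSmooth (g t))
    (hlin : ∀ t ∈ Icc a b, ∀ x, timeDerivWithin (Icc a b) w t x + convect (u t) (w t) x +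
      convect (w t) (u t) x = ν • laplacian (w t) x - gradient (q t) x + g t x)
    (hab : a < b) {t : ℝ} (ht : t ∈ Icc a b) :
    HasDerivWithinAt (fun s => gradNormSq (w s))
      (-(2 * ν * ∫ x, ‖laplacian (w t) x‖ ^ 2) +
        2 * (∫ x, ⟪convect (u t) (w t) x + convect (w t) (u t) x, laplacian (w t) x⟫_ℝ) -
        2 * ∫ x, ⟪g t x, laplacian (w t) x⟫_ℝ) (Icc a b) t := by
  have hU : UniqueDiffOn ℝ (Icc a b) := uniqueDiffOn_Icc hab
  have hwt : IsSmooth (w t) := hw.isSmooth_slice ht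
  have hut : IsSmooth (u t) := hu.isSmooth_slice ht
  have hqt : IsSmooth (q t) := hq.isSmooth_slice ht
  have hgt : IsSmooth (g t) := hg t ht
  have hA : IsSmooth (timeDerivWithin (Icc a b) w t) := hw.isSmooth_timeDerivWithin hU ht
  have hΔ : IsSmooth (laplacian (w t)) := hwt.laplacian
  have hderiv : ∀ x, timeDerivWithin (Icc a b) w t x =
      ν • laplacian (w t) x - gradient (q t) x + g t x -
        (convect (u t) (w t) x + convect (w t) (u t) x) := by
    intro x
    rw [← hlin t ht x]
    abel
  -- Step 1: `s ↦ -∫ ⟪Δ(w s), w s⟫` is differentiable within `[a, b]`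
  have hφ : IsSmoothSpaceTimeOn (Icc a b) (fun s x => ⟪laplacian (w s) x, w s x⟫_ℝ) :=
    (hw.laplacian hU).inner hw
  have hI := (hφ.hasDerivWithinAt_integral (convex_Icc a b) ht).neg
  -- Step 2: `∫ ∂ₜ⟪Δw, w⟫ = 2∫ ⟪∂ₜw, Δw⟫` (Green)
  have hpt : ∀ x, timeDerivWithin (Icc a b) (fun s x => ⟪laplacian (w s) x, w s x⟫_ℝ) t x =
      ⟪laplacian (w t) x, timeDerivWithin (Icc a b) w t x⟫_ℝ +
        ⟪laplacian (timeDerivWithin (Icc a b) w t) x, w t x⟫_ℝ := by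
    intro x
    rw [(hw.laplacian hU).timeDerivWithin_inner hw hU ht x,
      timeDerivWithin_laplacian_comm hab hw ht x]
  have hE' : -(∫ x, timeDerivWithin (Icc a b) (fun s x => ⟪laplacian (w s) x, w s x⟫_ℝ) t x) =
      -(2 * ∫ x, ⟪timeDerivWithin (Icc a b) w t x, laplacian (w t) x⟫_ℝ) := by
    simp_rw [hpt]
    rw [integral_add (hΔ.inner hA).integrable (hA.laplacian.inner hwt).integrable,
      integral_inner_laplacian_comm hA hwt]
    have hc : ∫ x, ⟪laplacian (w t) x, timeDerivWithin (Icc a b) w t x⟫_ℝ =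
        ∫ x, ⟪timeDerivWithin (Icc a b) w t x, laplacian (w t) x⟫_ℝ :=
      integral_congr_ae (ae_of_all _ fun x => real_inner_comm _ _)
    rw [hc]
    ring
  rw [hE'] at hI
  -- Step 3: insert the equation; the pressure term drops out
  have iL : Integrable (fun x => ⟪ν • laplacian (w t) x, laplacian (w t) x⟫_ℝ) volume :=
    ((hΔ.smul ν).inner hΔ).integrable
  have iC : Integrable (fun x => ⟪convect (u t) (w t) x + convect (w t) (u t) x,
      laplacian (w t) x⟫_ℝ) volume :=
    (((hut.convect hwt).add (hwt.convect hut)).inner hΔ).integrable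
  have iG : Integrable (fun x => ⟪gradient (q t) x, laplacian (w t) x⟫_ℝ) volume :=
    (hqt.gradient.inner hΔ).integrable
  have ig : Integrable (fun x => ⟪g t x, laplacian (w t) x⟫_ℝ) volume :=
    (hgt.inner hΔ).integrable
  have hsplit : ∫ x, ⟪timeDerivWithin (Icc a b) w t x, laplacian (w t) x⟫_ℝ =
      (∫ x, ⟪ν • laplacian (w t) x, laplacian (w t) x⟫_ℝ) -
        (∫ x, ⟪gradient (q t) x, laplacian (w t) x⟫_ℝ) +
        (∫ x, ⟪g t x, laplacian (w t) x⟫_ℝ) -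
        ∫ x, ⟪convect (u t) (w t) x + convect (w t) (u t) x, laplacian (w t) x⟫_ℝ := by
    have iLG : Integrable (fun x => ⟪ν • laplacian (w t) x, laplacian (w t) x⟫_ℝ -
        ⟪gradient (q t) x, laplacian (w t) x⟫_ℝ) volume := iL.sub iG
    have iLGg : Integrable (fun x => ⟪ν • laplacian (w t) x, laplacian (w t) x⟫_ℝ -
        ⟪gradient (q t) x, laplacian (w t) x⟫_ℝ + ⟪g t x, laplacian (w t) x⟫_ℝ) volume := iLG.add ig
    have hfun : (fun x => ⟪timeDerivWithin (Icc a b) w t x, laplacian (w t) x⟫_ℝ) = fun x =>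
        ⟪ν • laplacian (w t) x, laplacian (w t) x⟫_ℝ - ⟪gradient (q t) x, laplacian (w t) x⟫_ℝ +
          ⟪g t x, laplacian (w t) x⟫_ℝ -
          ⟪convect (u t) (w t) x + convect (w t) (u t) x, laplacian (w t) x⟫_ℝ := by
      funext x
      rw [hderiv x, inner_sub_left, inner_add_left, inner_sub_left]
    rw [hfun, integral_sub iLGg iC, integral_add iLG ig, integral_sub iL iG]
  have hvisc : ∫ x, ⟪ν • laplacian (w t) x, laplacian (w t) x⟫_ℝ =
      ν * ∫ x, ‖laplacian (w t) x‖ ^ 2 := by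
    rw [← integral_const_mul]
    refine integral_congr_ae (ae_of_all _ fun x => ?_)
    simp only [real_inner_smul_left, real_inner_self_eq_norm_sq]
  have hpres : ∫ x, ⟪gradient (q t) x, laplacian (w t) x⟫_ℝ = 0 :=
    integral_inner_gradient_eq_zero_of_isDivFree hΔ hqt
      (Literature.Analysis.FluidPDE.Torus.IsDivFree.laplacian_of_isSmooth hwt (hwdiv t ht))
  rw [hsplit, hvisc, hpres, sub_zero] at hI
  -- Step 4: `‖∇w‖₂² = -∫ ⟪Δw, w⟫` on `[a, b]`
  refine (hI.congr_of_mem (fun s hs => ?_) ht).congr_deriv (by ring)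
  have hws : IsSmooth (w s) := hw.isSmooth_slice hs
  have h := Literature.Analysis.FluidPDE.Torus.integral_inner_laplacian_self_eq_neg_gradNormSq hws
  change gradNormSq (w s) = -∫ x, ⟪laplacian (w s) x, w s x⟫_ℝ
  rw [h, neg_neg]

/-- **The `H¹` flux of the inhomogeneous linearised equation, keeping half the dissipation.** For
`ν > 0`, smooth fields `v, w, g` on `T^d` with `‖v‖ ≤ M` and `‖∂ᵢv‖ ≤ Cᵢ`, and
`C = (v·∇)w + (w·∇)v`:
`−2ν‖Δw‖₂² + 2∫⟪C, Δw⟫ − 2∫⟪g, Δw⟫ ≤ −ν‖Δw‖₂² + ν⁻¹(4|d|M²‖∇w‖₂² + 4(∑ᵢCᵢ)²∫‖w‖² + 2∫‖g‖²)`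
(Young `2⟪C − g, Δw⟫ ≤ ν‖Δw‖² + ν⁻¹‖C − g‖²`, `‖C − g‖² ≤ 2‖C‖² + 2‖g‖²`, and Temam's (6.17)
`‖C‖₂² ≤ 2|d|M²‖∇w‖₂² + 2(∑ᵢCᵢ)²‖w‖₂²`, `Torus.integral_norm_sq_convect_add_convect_le`).
[cite: Temam1997, Ch. III §6.2 (6.16)–(6.17)] -/
theorem linearisedNSForced_gradNormSq_flux_le (hν : 0 < ν)
    {v w g : UnitAddTorus d → EuclideanSpace ℝ d} (hv : IsSmooth v) (hw : IsSmooth w)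
    (hg : IsSmooth g) {M : ℝ} (hM : ∀ x, ‖v x‖ ≤ M)
    {C : d → ℝ} (hC : ∀ i x, ‖partialDeriv i v x‖ ≤ C i) :
    -(2 * ν * ∫ x, ‖laplacian w x‖ ^ 2) +
        2 * (∫ x, ⟪convect v w x + convect w v x, laplacian w x⟫_ℝ) -
        2 * ∫ x, ⟪g x, laplacian w x⟫_ℝ ≤
      -(ν * ∫ x, ‖laplacian w x‖ ^ 2) + ν⁻¹ * (4 * (Fintype.card d * M ^ 2) * gradNormSq w +
        4 * (∑ i, C i) ^ 2 * (∫ x, ‖w x‖ ^ 2) + 2 * ∫ x, ‖g x‖ ^ 2) := by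
  have hΔ : IsSmooth (laplacian w) := hw.laplacian
  have hCs : IsSmooth (fun x => convect v w x + convect w v x) := (hv.convect hw).add (hw.convect hv)
  have hF : IsSmooth (fun x => (convect v w x + convect w v x) - g x) := hCs.sub hg
  -- Young with `ν/2`
  have hY := Literature.Analysis.FluidPDE.Torus.neg_mul_integral_norm_sq_add_integral_inner_le
    (half_pos hν) hF hΔ
  -- `∫ ⟪C - g, Δw⟫ = ∫ ⟪C, Δw⟫ - ∫ ⟪g, Δw⟫`
  have hsplit : ∫ x, ⟪(convect v w x + convect w v x) - g x, laplacian w x⟫_ℝ =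
      (∫ x, ⟪convect v w x + convect w v x, laplacian w x⟫_ℝ) - ∫ x, ⟪g x, laplacian w x⟫_ℝ := by
    simp_rw [inner_sub_left]
    rw [integral_sub (hCs.inner hΔ).integrable (hg.inner hΔ).integrable]
  rw [hsplit] at hY
  -- `‖C - g‖₂² ≤ 2‖C‖₂² + 2‖g‖₂²`
  have hpt : ∀ x, ‖(convect v w x + convect w v x) - g x‖ ^ 2 ≤
      2 * ‖convect v w x + convect w v x‖ ^ 2 + 2 * ‖g x‖ ^ 2 := by
    intro x
    have h := norm_sub_le (convect v w x + convect w v x) (g x)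
    nlinarith [norm_nonneg ((convect v w x + convect w v x) - g x),
      norm_nonneg (convect v w x + convect w v x), norm_nonneg (g x),
      sq_nonneg (‖convect v w x + convect w v x‖ - ‖g x‖)]
  have hFle : ∫ x, ‖(convect v w x + convect w v x) - g x‖ ^ 2 ≤
      2 * (∫ x, ‖convect v w x + convect w v x‖ ^ 2) + 2 * ∫ x, ‖g x‖ ^ 2 := by
    have h : ∫ x, ‖(convect v w x + convect w v x) - g x‖ ^ 2 ≤
        ∫ x, (2 * ‖convect v w x + convect w v x‖ ^ 2 + 2 * ‖g x‖ ^ 2) :=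
      integral_mono hF.norm_sq.integrable
        ((hCs.norm_sq.integrable.const_mul 2).add (hg.norm_sq.integrable.const_mul 2)) hpt
    rwa [integral_add (hCs.norm_sq.integrable.const_mul 2) (hg.norm_sq.integrable.const_mul 2),
      integral_const_mul, integral_const_mul] at h
  have hB := integral_norm_sq_convect_add_convect_le (u₁ := v) hv hw hM hC
  have hν0 : 0 < ν⁻¹ := inv_pos.2 hν
  have h4 : (4 * (ν / 2))⁻¹ = 2⁻¹ * ν⁻¹ := by
    rw [mul_inv]; field_simp; norm_num
  rw [h4] at hY
  have hG0 : 0 ≤ ∫ x, ‖g x‖ ^ 2 := integral_nonneg fun x => sq_nonneg _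
  nlinarith [hY, mul_le_mul_of_nonneg_left hFle hν0.le, mul_le_mul_of_nonneg_left hB hν0.le, hG0]

end Torus

end Literature.Analysis.FunctionSpaces
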